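import Literature.ModelTheory.ExponentialFields.OMinimalFinitenessNormal
import HarnessLib

/-!
# The Finiteness Lemma for o-minimal structures, II: the bad points are finite in number

Topic `Literature/ModelTheory/ExponentialFields`.  Continuation of
`OMinimalFinitenessNormal.lean` (L. van den Dries, *Tame topology and o-minimal structures*
(1998), Ch. 3, proof of the Finiteness Lemma (1.7), second half, pp. 63–64): for a definable
`A ⊆ M²` with finite fibres in an o-minimal structure on a dense linear order without endpoints
(`<` definable), **the set `𝓑` of bad points is finite** (`finite_setOf_not_good`).

Van den Dries: "Suppose now that `𝓑` is not finite. We shall derive a contradiction."  Being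
definable and infinite, `𝓑` would contain an open interval, and so would one of the three
definable sets into which we cut it:

* points `a` with `(a, -∞)` not normal (`false_of_forall_not_normalBot`): on a subinterval the
  definable function `x ↦ min A_x` is continuous (monotonicity theorem), which makes `(a, -∞)`
  normal — van den Dries's case `β ≡ -∞`;
* points with `(a, +∞)` not normal (`false_of_forall_not_normalTop`), symmetrically;
* points with `(a, ±∞)` normal and a non-normal `(a, b)`, `b ∈ M` (`false_of_forall_isLeast`):
  here `β(a) =` the least non-normal height (it exists, `exists_isLeast_not_normal`) and
  `β₋(a) = max {y < β(a) : (a, y) ∈ A}`, `β₊(a) = min {y > β(a) : (a, y) ∈ A}` are definable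
  functions; by the monotonicity theorem they are continuous on a subinterval `I`, which we
  shrink further so that either `Γ(β|I) ⊆ A` or `Γ(β|I) ∩ A = ∅` and so that `I` lies in one
  of `𝓑₋ ∩ 𝓑₊`, `𝓑₋ - 𝓑₊`, `𝓑₊ - 𝓑₋`, `𝓑 - (𝓑₋ ∪ 𝓑₊)` (van den Dries's four cases); in each
  case continuity clears a box around `(a, β(a))` in which `A` is empty or the graph of `β`,
  i.e. `(a, β(a))` is normal after all (`normal_of_eventually_eq_apply`).

Nothing here is a named fact.

## References

* [Dries1998] L. van den Dries, *Tame topology and o-minimal structures*, London Math. Soc.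
  Lecture Note Series 248, CUP 1998, Ch. 3, (1.7), pp. 62–64.
* [KnightPillaySteinhorn1986] J. Knight, A. Pillay, C. Steinhorn, *Definable sets in ordered
  structures II*, Trans. AMS 295 (1986) 593–605.
-/

open Set FirstOrder FirstOrder.Language
open _root_.Filter _root_.Topology

namespace Literature.ModelTheory.ExponentialFields

universe u v

namespace FinitenessLemma

variable {L : Language.{u, v}} {M : Type*} [L.Structure M] [LinearOrder M] {A : M → M → Prop}

/-! ### Definable selections -/

/-- The graph of a function which picks the least `y` with `Q x y` when there is one and is the
identity otherwise is definable when `Q` and `<` are (van den Dries 1998, Ch. 1, (2.3); the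
form in which "`f_n(x) := n`-th element of `A_x` is definable" enters Ch. 3, (1.7)). [cite: Dries1998, Ch. 3 (1.7)] -/
theorem definable_graph_of_isLeast_or_eq
    (hlt : (univ : Set M).Definable L {v : Fin 2 → M | v 0 < v 1})
    {Q : M → M → Prop} (hQ : (univ : Set M).Definable L {v : Fin 2 → M | Q (v 0) (v 1)})
    {f : M → M} (hf : ∀ x, (∃ y, Q x y) → Q x (f x) ∧ ∀ y, Q x y → f x ≤ y)
    (hf' : ∀ x, (¬ ∃ y, Q x y) → f x = x) :
    (univ : Set M).Definable L {v : Fin 2 → M | v 1 = f (v 0)} := by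
  have hdef : (univ : Set M).Definable L {v : Fin 2 → M |
      ((∃ y, Q (v 0) y) ∧ Q (v 0) (v 1) ∧ ∀ y, Q (v 0) y → v 1 ≤ y) ∨
      ((¬ ∃ y, Q (v 0) y) ∧ v 1 = v 0)} := by
    repeat (first
      | exact definable_setOf_le hlt (definableFun_proj _) (definableFun_proj _)
      | exact definable_setOf_rel hQ (definableFun_proj _) (definableFun_proj _)
      | exact definable_setOf_eq' (definableFun_proj _) (definableFun_proj _)
      | refine definable_setOf_and ?_ ?_
      | refine definable_setOf_or ?_ ?_
      | refine definable_setOf_not ?_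
      | refine definable_setOf_imp ?_ ?_
      | apply definable_setOf_forall
      | apply definable_setOf_exists)
  convert hdef using 1
  ext v
  simp only [mem_setOf_eq]
  constructor
  · intro hv
    rw [hv]
    by_cases hx : ∃ y, Q (v 0) y
    · exact Or.inl ⟨hx, hf _ hx⟩
    · exact Or.inr ⟨hx, hf' _ hx⟩
  · rintro (⟨hx, h₁, h₂⟩ | ⟨hx, h₁⟩)
    · exact le_antisymm (h₂ _ (hf _ hx).1) ((hf _ hx).2 _ h₁)
    · rw [h₁, hf' _ hx]

/-- The graph of a function which picks the greatest `y` with `Q x y` when there is one and is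
the identity otherwise is definable when `Q` and `<` are (van den Dries 1998, Ch. 1, (2.3)). [cite: Dries1998, Ch. 3 (1.7)] -/
theorem definable_graph_of_isGreatest_or_eq
    (hlt : (univ : Set M).Definable L {v : Fin 2 → M | v 0 < v 1})
    {Q : M → M → Prop} (hQ : (univ : Set M).Definable L {v : Fin 2 → M | Q (v 0) (v 1)})
    {f : M → M} (hf : ∀ x, (∃ y, Q x y) → Q x (f x) ∧ ∀ y, Q x y → y ≤ f x)
    (hf' : ∀ x, (¬ ∃ y, Q x y) → f x = x) :
    (univ : Set M).Definable L {v : Fin 2 → M | v 1 = f (v 0)} := by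
  have hdef : (univ : Set M).Definable L {v : Fin 2 → M |
      ((∃ y, Q (v 0) y) ∧ Q (v 0) (v 1) ∧ ∀ y, Q (v 0) y → y ≤ v 1) ∨
      ((¬ ∃ y, Q (v 0) y) ∧ v 1 = v 0)} := by
    repeat (first
      | exact definable_setOf_le hlt (definableFun_proj _) (definableFun_proj _)
      | exact definable_setOf_rel hQ (definableFun_proj _) (definableFun_proj _)
      | exact definable_setOf_eq' (definableFun_proj _) (definableFun_proj _)
      | refine definable_setOf_and ?_ ?_
      | refine definable_setOf_or ?_ ?_
      | refine definable_setOf_not ?_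
      | refine definable_setOf_imp ?_ ?_
      | apply definable_setOf_forall
      | apply definable_setOf_exists)
  convert hdef using 1
  ext v
  simp only [mem_setOf_eq]
  constructor
  · intro hv
    rw [hv]
    by_cases hx : ∃ y, Q (v 0) y
    · exact Or.inl ⟨hx, hf _ hx⟩
    · exact Or.inr ⟨hx, hf' _ hx⟩
  · rintro (⟨hx, h₁, h₂⟩ | ⟨hx, h₁⟩)
    · exact le_antisymm ((hf _ hx).2 _ h₁) (h₂ _ (hf _ hx).1)
    · rw [h₁, hf' _ hx]

/-- The least point of a finite set satisfying a condition, or a default: the selection used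
for `min A_x`, `β₊` (a total function `M → M`). [cite: Dries1998, Ch. 3 (1.7)] -/
theorem exists_fun_isLeast_or_eq (Q : M → M → Prop) (hfin : ∀ x, {y | Q x y}.Finite) :
    ∃ f : M → M, (∀ x, (∃ y, Q x y) → Q x (f x) ∧ ∀ y, Q x y → f x ≤ y) ∧
      ∀ x, (¬ ∃ y, Q x y) → f x = x := by
  classical
  refine ⟨fun x => if h : (hfin x).toFinset.Nonempty then (hfin x).toFinset.min' h else x,
    fun x hx => ?_, fun x hx => ?_⟩
  · have hne : (hfin x).toFinset.Nonempty := by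
      obtain ⟨y, hy⟩ := hx
      exact ⟨y, (hfin x).mem_toFinset.2 hy⟩
    simp only [dif_pos hne]
    exact ⟨(hfin x).mem_toFinset.1 (Finset.min'_mem _ hne),
      fun y hy => Finset.min'_le _ _ ((hfin x).mem_toFinset.2 hy)⟩
  · have hne : ¬ (hfin x).toFinset.Nonempty := fun ⟨y, hy⟩ => hx ⟨y, (hfin x).mem_toFinset.1 hy⟩
    simp only [dif_neg hne]

/-- The greatest point of a finite set satisfying a condition, or a default: the selection
used for `max A_x`, `β₋`. [cite: Dries1998, Ch. 3 (1.7)] -/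
theorem exists_fun_isGreatest_or_eq (Q : M → M → Prop) (hfin : ∀ x, {y | Q x y}.Finite) :
    ∃ f : M → M, (∀ x, (∃ y, Q x y) → Q x (f x) ∧ ∀ y, Q x y → y ≤ f x) ∧
      ∀ x, (¬ ∃ y, Q x y) → f x = x := by
  classical
  refine ⟨fun x => if h : (hfin x).toFinset.Nonempty then (hfin x).toFinset.max' h else x,
    fun x hx => ?_, fun x hx => ?_⟩
  · have hne : (hfin x).toFinset.Nonempty := by
      obtain ⟨y, hy⟩ := hx
      exact ⟨y, (hfin x).mem_toFinset.2 hy⟩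
    simp only [dif_pos hne]
    exact ⟨(hfin x).mem_toFinset.1 (Finset.max'_mem _ hne),
      fun y hy => Finset.le_max' _ _ ((hfin x).mem_toFinset.2 hy)⟩
  · have hne : ¬ (hfin x).toFinset.Nonempty := fun ⟨y, hy⟩ => hx ⟨y, (hfin x).mem_toFinset.1 hy⟩
    simp only [dif_neg hne]

variable [DenselyOrdered M] [NoMinOrder M] [NoMaxOrder M]

section Topology

variable [TopologicalSpace M] [OrderTopology M]

omit [DenselyOrdered M] [NoMinOrder M] [NoMaxOrder M] in
/-- From the alternative delivered by the monotonicity theorem on an interval to continuity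
there. [cite: Dries1998, Ch. 3 (1.2)] -/
theorem continuousOn_of_const_or {f : M → M} {c d : M}
    (h : (∀ x ∈ Ioo c d, ∀ y ∈ Ioo c d, f x = f y) ∨
      ((StrictMonoOn f (Ioo c d) ∨ StrictAntiOn f (Ioo c d)) ∧ ContinuousOn f (Ioo c d))) :
    ContinuousOn f (Ioo c d) := by
  rcases h with h | ⟨-, h⟩
  · exact continuousOn_Ioo_of_const h
  · exact h

/-- Three definable functions are simultaneously continuous on some initial subinterval
`(c, d')`, `c < d' ≤ d`, of a given interval `(c, d)` (monotonicity theorem, three finite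
exceptional sets avoided at once). [cite: Dries1998, Ch. 3 (1.2)] -/
theorem exists_continuousOn_three (hO : L.IsOMinimal M)
    (hlt : (univ : Set M).Definable L {v : Fin 2 → M | v 0 < v 1})
    {f₁ f₂ f₃ : M → M}
    (h₁ : (univ : Set M).Definable L {v : Fin 2 → M | v 1 = f₁ (v 0)})
    (h₂ : (univ : Set M).Definable L {v : Fin 2 → M | v 1 = f₂ (v 0)})
    (h₃ : (univ : Set M).Definable L {v : Fin 2 → M | v 1 = f₃ (v 0)})
    {c d : M} (hcd : c < d) :
    ∃ d', c < d' ∧ d' ≤ d ∧ ContinuousOn f₁ (Ioo c d') ∧ ContinuousOn f₂ (Ioo c d') ∧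
      ContinuousOn f₃ (Ioo c d') := by
  classical
  obtain ⟨F₁, hF₁⟩ := monotonicity_continuousOn hO hlt h₁
  obtain ⟨F₂, hF₂⟩ := monotonicity_continuousOn hO hlt h₂
  obtain ⟨F₃, hF₃⟩ := monotonicity_continuousOn hO hlt h₃
  obtain ⟨e, hce, he⟩ := exists_gt_forall_notMem_Ioo (F₁ ∪ F₂ ∪ F₃) c
  refine ⟨min e d, lt_min hce hcd, min_le_right _ _, ?_, ?_, ?_⟩
  · refine continuousOn_of_const_or (hF₁ c _ fun z hz hz' => he z ?_ ⟨hz'.1, ?_⟩)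
    · simp [hz]
    · exact lt_of_lt_of_le hz'.2 (min_le_left _ _)
  · refine continuousOn_of_const_or (hF₂ c _ fun z hz hz' => he z ?_ ⟨hz'.1, ?_⟩)
    · simp [hz]
    · exact lt_of_lt_of_le hz'.2 (min_le_left _ _)
  · refine continuousOn_of_const_or (hF₃ c _ fun z hz hz' => he z ?_ ⟨hz'.1, ?_⟩)
    · simp [hz]
    · exact lt_of_lt_of_le hz'.2 (min_le_left _ _)

/-! ### Bad points with `(a, -∞)` or `(a, +∞)` not normal -/

/-- **No interval of points `a` with `(a, -∞)` not normal** (van den Dries 1998, Ch. 3, proof of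
(1.7), the case `β ≡ -∞` of "each of these four cases leads to a contradiction"): on a
subinterval where every fibre is non-empty, `x ↦ min A_x` is definable, hence continuous on a
smaller interval (monotonicity), and below a continuous function there is locally a box free
of `A`. [cite: Dries1998, Ch. 3 (1.7)] -/
theorem false_of_forall_not_normalBot (hO : L.IsOMinimal M)
    (hlt : (univ : Set M).Definable L {v : Fin 2 → M | v 0 < v 1})
    (hA : (univ : Set M).Definable L {v : Fin 2 → M | A (v 0) (v 1)})
    (hfin : ∀ x, {y | A x y}.Finite) {c d : M} (hcd : c < d)
    (hbad : ∀ a, c < a → a < d → ¬ NormalBot A a) : False := by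
  classical
  -- the set of `x` with non-empty fibre, near `c⁺`
  have hSdef : (univ : Set M).Definable₁ L {x | ∃ y, A x y} := by
    show (univ : Set M).Definable L {v : Fin 1 → M | ∃ y, A (v 0) y}
    apply definable_setOf_exists
    exact definable_setOf_rel hA (definableFun_proj _) (definableFun_proj _)
  obtain ⟨e, hce, he⟩ := (hO _ hSdef).exists_Ioo_subset_or_disjoint_right c
  rcases he with he | he
  · -- `m x = min A_x` on `(c, e)`
    obtain ⟨m, hm, hm'⟩ := exists_fun_isLeast_or_eq A hfin
    have hmdef := definable_graph_of_isLeast_or_eq hlt hA hm hm'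
    obtain ⟨d', hcd', hd'd, hmc, -, -⟩ :=
      exists_continuousOn_three hO hlt hmdef hmdef hmdef (lt_min hce hcd)
    obtain ⟨a, hca, had'⟩ := exists_between hcd'
    have hae : a < e := lt_of_lt_of_le had' (hd'd.trans (min_le_left _ _))
    have had : a < d := lt_of_lt_of_le had' (hd'd.trans (min_le_right _ _))
    obtain ⟨q, hq⟩ := exists_lt (m a)
    have hev : ∀ᶠ x in 𝓝 a, q < m x ∧ x ∈ Ioo c d' :=
      ((hmc.continuousAt (Ioo_mem_nhds hca had')).eventually (Ioi_mem_nhds hq)).and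
        (Ioo_mem_nhds hca had')
    obtain ⟨⟨x₁, x₂⟩, ⟨hx₁, hx₂⟩, hx⟩ := (nhds_basis_Ioo a).eventually_iff.1 hev
    refine hbad a hca had ⟨x₁, x₂, q, hx₁, hx₂, fun x hx₁' hx₂' y hyq hxy => ?_⟩
    obtain ⟨hqm, hxc, hxd'⟩ := hx (show x ∈ Ioo x₁ x₂ from ⟨hx₁', hx₂'⟩)
    have hxS : x ∈ {x | ∃ y, A x y} :=
      he ⟨hxc, lt_of_lt_of_le hxd' (hd'd.trans (min_le_left _ _))⟩
    exact absurd ((hm x hxS).2 y hxy) (not_le.2 (hyq.trans hqm))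
  · -- empty fibres on `(c, e)`: every `(a, -∞)` there is normal
    obtain ⟨a, hca, hae⟩ := exists_between (lt_min hce hcd)
    refine hbad a hca (lt_of_lt_of_le hae (min_le_right _ _))
      ⟨c, min e d, a, hca, hae, fun x hx₁ hx₂ y _ hxy => ?_⟩
    exact disjoint_left.1 he ⟨hx₁, lt_of_lt_of_le hx₂ (min_le_left _ _)⟩ ⟨y, hxy⟩

/-- **No interval of points `a` with `(a, +∞)` not normal** (van den Dries 1998, Ch. 3, proof
of (1.7), the case `β ≡ +∞`), symmetrically with `x ↦ max A_x`. [cite: Dries1998, Ch. 3 (1.7)] -/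
theorem false_of_forall_not_normalTop (hO : L.IsOMinimal M)
    (hlt : (univ : Set M).Definable L {v : Fin 2 → M | v 0 < v 1})
    (hA : (univ : Set M).Definable L {v : Fin 2 → M | A (v 0) (v 1)})
    (hfin : ∀ x, {y | A x y}.Finite) {c d : M} (hcd : c < d)
    (hbad : ∀ a, c < a → a < d → ¬ NormalTop A a) : False := by
  classical
  have hSdef : (univ : Set M).Definable₁ L {x | ∃ y, A x y} := by
    show (univ : Set M).Definable L {v : Fin 1 → M | ∃ y, A (v 0) y}
    apply definable_setOf_exists
    exact definable_setOf_rel hA (definableFun_proj _) (definableFun_proj _)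
  obtain ⟨e, hce, he⟩ := (hO _ hSdef).exists_Ioo_subset_or_disjoint_right c
  rcases he with he | he
  · obtain ⟨m, hm, hm'⟩ := exists_fun_isGreatest_or_eq A hfin
    have hmdef := definable_graph_of_isGreatest_or_eq hlt hA hm hm'
    obtain ⟨d', hcd', hd'd, hmc, -, -⟩ :=
      exists_continuousOn_three hO hlt hmdef hmdef hmdef (lt_min hce hcd)
    obtain ⟨a, hca, had'⟩ := exists_between hcd'
    have had : a < d := lt_of_lt_of_le had' (hd'd.trans (min_le_right _ _))
    obtain ⟨q, hq⟩ := exists_gt (m a)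
    have hev : ∀ᶠ x in 𝓝 a, m x < q ∧ x ∈ Ioo c d' :=
      ((hmc.continuousAt (Ioo_mem_nhds hca had')).eventually (Iio_mem_nhds hq)).and
        (Ioo_mem_nhds hca had')
    obtain ⟨⟨x₁, x₂⟩, ⟨hx₁, hx₂⟩, hx⟩ := (nhds_basis_Ioo a).eventually_iff.1 hev
    refine hbad a hca had ⟨x₁, x₂, q, hx₁, hx₂, fun x hx₁' hx₂' y hqy hxy => ?_⟩
    obtain ⟨hmq, hxc, hxd'⟩ := hx (show x ∈ Ioo x₁ x₂ from ⟨hx₁', hx₂'⟩)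
    have hxS : x ∈ {x | ∃ y, A x y} :=
      he ⟨hxc, lt_of_lt_of_le hxd' (hd'd.trans (min_le_left _ _))⟩
    exact absurd ((hm x hxS).2 y hxy) (not_le.2 (hmq.trans hqy))
  · obtain ⟨a, hca, hae⟩ := exists_between (lt_min hce hcd)
    refine hbad a hca (lt_of_lt_of_le hae (min_le_right _ _))
      ⟨c, min e d, a, hca, hae, fun x hx₁ hx₂ y _ hxy => ?_⟩
    exact disjoint_left.1 he ⟨hx₁, lt_of_lt_of_le hx₂ (min_le_left _ _)⟩ ⟨y, hxy⟩

/-! ### Bad points with a least non-normal height -/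

omit [DenselyOrdered M] in
/-- The box argument common to van den Dries's four cases: if near `a` the function `β` is the
only possible point of `A` at heights in `(p, q) ∋ β(a)`, `β` is continuous at `a`, and near `a`
the graph of `β` lies in `A` or misses `A`, then `(a, β(a))` is normal ("in either case it is
clear that `Γ(β|I)` consists of normal points"). [cite: Dries1998, Ch. 3 (1.7)] -/
theorem normal_of_eventually_eq_apply {β : M → M} {a p q : M} (hp : p < β a) (hq : β a < q)
    (hcont : ContinuousAt β a)
    (hev : ∀ᶠ x in 𝓝 a, p < β x ∧ β x < q ∧ ∀ y, p < y → y < q → A x y → y = β x)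
    (hunif : (∀ᶠ x in 𝓝 a, A x (β x)) ∨ (∀ᶠ x in 𝓝 a, ¬ A x (β x))) :
    Normal A a (β a) := by
  rcases hunif with hin | hout
  · refine Or.inr ⟨hin.self_of_nhds, ?_⟩
    obtain ⟨⟨x₁, x₂⟩, ⟨hx₁, hx₂⟩, hx⟩ := (nhds_basis_Ioo a).eventually_iff.1 (hev.and hin)
    refine ⟨x₁, x₂, p, q, hx₁, hx₂, hp, hq, fun x h₁ h₂ => ?_, fun x h₁ h₂ y hy₁ hy₂ y' hy₁' hy₂' hy hy' => ?_,
      fun v₁ v₂ hv₁ hv₂ => ?_⟩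
    · obtain ⟨⟨h₃, h₄, -⟩, h₅⟩ := hx (show x ∈ Ioo x₁ x₂ from ⟨h₁, h₂⟩)
      exact ⟨β x, h₃, h₄, h₅⟩
    · obtain ⟨⟨-, -, h₃⟩, -⟩ := hx (show x ∈ Ioo x₁ x₂ from ⟨h₁, h₂⟩)
      rw [h₃ y hy₁ hy₂ hy, h₃ y' hy₁' hy₂' hy']
    · have hev' : ∀ᶠ x in 𝓝 a, β x ∈ Ioo v₁ v₂ := hcont.eventually (Ioo_mem_nhds hv₁ hv₂)
      obtain ⟨⟨u₁, u₂⟩, ⟨hu₁, hu₂⟩, hu⟩ := (nhds_basis_Ioo a).eventually_iff.1 (hev.and hev')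
      refine ⟨u₁, u₂, hu₁, hu₂, fun x h₁ h₂ y hy₁ hy₂ hy => ?_⟩
      obtain ⟨⟨-, -, h₃⟩, h₄⟩ := hu (show x ∈ Ioo u₁ u₂ from ⟨h₁, h₂⟩)
      rw [h₃ y hy₁ hy₂ hy]
      exact h₄
  · obtain ⟨⟨x₁, x₂⟩, ⟨hx₁, hx₂⟩, hx⟩ := (nhds_basis_Ioo a).eventually_iff.1 (hev.and hout)
    refine Or.inl ⟨x₁, x₂, p, q, hx₁, hx₂, hp, hq, fun x h₁ h₂ y hy₁ hy₂ hy => ?_⟩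
    obtain ⟨⟨-, -, h₃⟩, h₄⟩ := hx (show x ∈ Ioo x₁ x₂ from ⟨h₁, h₂⟩)
    exact h₄ (h₃ y hy₁ hy₂ hy ▸ hy)

omit [DenselyOrdered M] [NoMinOrder M] [NoMaxOrder M] in
/-- Assembling the heights `p < β(a) < q` of the box from a lower datum and an upper datum
(the lower datum says: near `a`, points of `A_x` below `β(x)` are below `p`; it comes from the
continuity of `β₋` on `𝓑₋` and is vacuous off `𝓑₋`; dually for the upper datum). [cite: Dries1998, Ch. 3 (1.7)] -/
theorem eventually_eq_apply_of_lower_upper {β : M → M} {a p q : M}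
    (hcont : ContinuousAt β a) (hp : p < β a) (hq : β a < q)
    (hlow : ∀ᶠ x in 𝓝 a, ∀ y, A x y → y < β x → y < p)
    (hupp : ∀ᶠ x in 𝓝 a, ∀ y, A x y → β x < y → q < y) :
    ∀ᶠ x in 𝓝 a, p < β x ∧ β x < q ∧ ∀ y, p < y → y < q → A x y → y = β x := by
  have hβ : ∀ᶠ x in 𝓝 a, β x ∈ Ioo p q := hcont.eventually (Ioo_mem_nhds hp hq)
  filter_upwards [hβ, hlow, hupp] with x hx hl hu
  refine ⟨hx.1, hx.2, fun y hpy hyq hy => ?_⟩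
  rcases lt_trichotomy y (β x) with h | h | h
  · exact absurd (hl y hy h) (not_lt.2 hpy.le)
  · exact h
  · exact absurd (hu y hy h) (not_lt.2 hyq.le)

/-- **No interval of points `a` with `(a, ±∞)` normal and some `(a, b)` not normal**
(van den Dries 1998, Ch. 3, proof of (1.7): "Suppose now that `𝓑` is not finite … each of
these four cases leads to a contradiction"), with `β(a)` the least non-normal height,
`β₋ = max (A_a ∩ (-∞, β(a)))`, `β₊ = min (A_a ∩ (β(a), +∞))`, all three continuous on a
subinterval by the monotonicity theorem. [cite: Dries1998, Ch. 3 (1.7)] -/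
theorem false_of_forall_isLeast (hO : L.IsOMinimal M)
    (hlt : (univ : Set M).Definable L {v : Fin 2 → M | v 0 < v 1})
    (hA : (univ : Set M).Definable L {v : Fin 2 → M | A (v 0) (v 1)})
    (hfin : ∀ x, {y | A x y}.Finite) {c d : M} (hcd : c < d)
    (hbad : ∀ a, c < a → a < d → NormalBot A a ∧ NormalTop A a ∧ ∃ b, ¬ Normal A a b) :
    False := by
  classical
  -- the least non-normal height `β`
  set P : M → M → Prop := fun a b => ¬ Normal A a b ∧ ∀ b', ¬ Normal A a b' → b ≤ b' with hP
  have hPdef : ∀ {α : Type} (i j : α),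
      (univ : Set M).Definable L {v : α → M | P (v i) (v j)} := by
    intro α i j
    refine definable_setOf_and (definable_setOf_not (definable_setOf_rel
      (definable_setOf_normal hlt hA) (definableFun_proj i) (definableFun_proj j))) ?_
    apply definable_setOf_forall
    exact definable_setOf_imp (definable_setOf_not (definable_setOf_rel
      (definable_setOf_normal hlt hA) (definableFun_proj _) (definableFun_proj _)))
      (definable_setOf_le hlt (definableFun_proj _) (definableFun_proj _))
  have hPex : ∀ a, c < a → a < d → ∃ b, P a b := fun a hca had =>
    exists_isLeast_not_normal hO hlt hA (hbad a hca had).1 (hbad a hca had).2.2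
  have hPuniq : ∀ a b b', P a b → P a b' → b = b' := fun a b b' h h' =>
    le_antisymm (h.2 _ h'.1) (h'.2 _ h.1)
  let β : M → M := fun a => if h : ∃ b, P a b then h.choose else a
  have hβP : ∀ a, (∃ b, P a b) → P a (β a) := fun a h => by
    simp only [β, dif_pos h]
    exact h.choose_spec
  have hβ' : ∀ a, (¬ ∃ b, P a b) → β a = a := fun a h => by simp only [β, dif_neg h]
  have hβdef : (univ : Set M).Definable L {v : Fin 2 → M | v 1 = β (v 0)} := by
    have hdef : (univ : Set M).Definable L
        {v : Fin 2 → M | P (v 0) (v 1) ∨ ((¬ ∃ b, P (v 0) b) ∧ v 1 = v 0)} := by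
      refine definable_setOf_or (hPdef 0 1) (definable_setOf_and (definable_setOf_not ?_)
        (definable_setOf_eq' (definableFun_proj _) (definableFun_proj _)))
      apply definable_setOf_exists
      exact hPdef _ _
    convert hdef using 1
    ext v
    simp only [mem_setOf_eq]
    constructor
    · intro hv
      rw [hv]
      by_cases h : ∃ b, P (v 0) b
      · exact Or.inl (hβP _ h)
      · exact Or.inr ⟨h, hβ' _ h⟩
    · rintro (h | ⟨h, h'⟩)
      · exact hPuniq _ _ _ h (hβP _ ⟨_, h⟩)
      · rw [h', hβ' _ h]
  have hβfun : ∀ {α : Type} (i : α),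
      (univ : Set M).DefinableFun L (fun v : α → M => β (v i)) :=
    fun i => definableFun_apply hβdef (definableFun_proj i)
  -- `β₋ = max (A_a ∩ (-∞, β a))`, `β₊ = min (A_a ∩ (β a, +∞))`
  obtain ⟨βm, hβm, hβm'⟩ := exists_fun_isGreatest_or_eq (fun a y => A a y ∧ y < β a)
    (fun a => (hfin a).subset fun y hy => hy.1)
  obtain ⟨βp, hβp, hβp'⟩ := exists_fun_isLeast_or_eq (fun a y => A a y ∧ β a < y)
    (fun a => (hfin a).subset fun y hy => hy.1)
  have hQm : ∀ {α : Type} (i j : α),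
      (univ : Set M).Definable L {v : α → M | A (v i) (v j) ∧ v j < β (v i)} :=
    fun i j => definable_setOf_and (definable_setOf_rel hA (definableFun_proj i)
      (definableFun_proj j)) (definable_setOf_lt hlt (definableFun_proj j) (hβfun i))
  have hQp : ∀ {α : Type} (i j : α),
      (univ : Set M).Definable L {v : α → M | A (v i) (v j) ∧ β (v i) < v j} :=
    fun i j => definable_setOf_and (definable_setOf_rel hA (definableFun_proj i)
      (definableFun_proj j)) (definable_setOf_lt hlt (hβfun i) (definableFun_proj j))
  have hβmdef : (univ : Set M).Definable L {v : Fin 2 → M | v 1 = βm (v 0)} :=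
    definable_graph_of_isGreatest_or_eq hlt (hQm (0 : Fin 2) 1) hβm hβm'
  have hβpdef : (univ : Set M).Definable L {v : Fin 2 → M | v 1 = βp (v 0)} :=
    definable_graph_of_isLeast_or_eq hlt (hQp (0 : Fin 2) 1) hβp hβp'
  -- an initial subinterval on which `β`, `β₋`, `β₊` are continuous
  obtain ⟨d₂, hcd₂, hd₂d, hβc, hβmc, hβpc⟩ :=
    exists_continuousOn_three hO hlt hβdef hβmdef hβpdef hcd
  -- … and on which the graph of `β` lies in `A` or misses `A`
  have hS'def : (univ : Set M).Definable₁ L {x | A x (β x)} :=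
    definable_setOf_rel hA (definableFun_proj (0 : Fin 1)) (hβfun 0)
  obtain ⟨e₃, hce₃, he₃⟩ := (hO _ hS'def).exists_Ioo_subset_or_disjoint_right c
  set d₃ := min e₃ d₂ with hd₃
  have hcd₃ : c < d₃ := lt_min hce₃ hcd₂
  have hunif : (∀ x ∈ Ioo c d₃, A x (β x)) ∨ (∀ x ∈ Ioo c d₃, ¬ A x (β x)) := by
    rcases he₃ with h | h
    · exact Or.inl fun x hx => h ⟨hx.1, lt_of_lt_of_le hx.2 (min_le_left _ _)⟩
    · exact Or.inr fun x hx hx' =>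
        disjoint_left.1 h ⟨hx.1, lt_of_lt_of_le hx.2 (min_le_left _ _)⟩ hx'
  -- van den Dries's `𝓑₋`, `𝓑₊`
  set Bm : Set M := {a | ∃ y, A a y ∧ y < β a} with hBm
  set Bp : Set M := {a | ∃ y, A a y ∧ β a < y} with hBp
  have hBmdef : (univ : Set M).Definable₁ L Bm := by
    show (univ : Set M).Definable L {v : Fin 1 → M | ∃ y, A (v 0) y ∧ y < β (v 0)}
    apply definable_setOf_exists
    exact hQm _ _
  have hBpdef : (univ : Set M).Definable₁ L Bp := by
    show (univ : Set M).Definable L {v : Fin 1 → M | ∃ y, A (v 0) y ∧ β (v 0) < y}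
    apply definable_setOf_exists
    exact hQp _ _
  have hIdef : (univ : Set M).Definable₁ L (Ioo c d₃) :=
    definable_setOf_and
      (definable_setOf_lt hlt (definableFun_const' _ c) (definableFun_proj (0 : Fin 1)))
      (definable_setOf_lt hlt (definableFun_proj (0 : Fin 1)) (definableFun_const' _ d₃))
  -- the box argument on a subinterval lying in one of the four pieces
  have key : ∀ c₄ d₄, c₄ < d₄ → Ioo c₄ d₄ ⊆ Ioo c d₃ →
      (Ioo c₄ d₄ ⊆ Bm ∨ Ioo c₄ d₄ ⊆ Bmᶜ) → (Ioo c₄ d₄ ⊆ Bp ∨ Ioo c₄ d₄ ⊆ Bpᶜ) → False := by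
    intro c₄ d₄ hcd₄ hsub hm hp
    obtain ⟨a, hc₄a, had₄⟩ := exists_between hcd₄
    have haI : a ∈ Ioo c d₃ := hsub ⟨hc₄a, had₄⟩
    have had₂ : a < d₂ := lt_of_lt_of_le haI.2 (min_le_right _ _)
    have had : a < d := lt_of_lt_of_le had₂ hd₂d
    have hnhd : ∀ᶠ x in 𝓝 a, x ∈ Ioo c₄ d₄ := Ioo_mem_nhds hc₄a had₄
    have hIoo₂ : Ioo c d₂ ∈ 𝓝 a := Ioo_mem_nhds haI.1 had₂
    have hβa : ContinuousAt β a := hβc.continuousAt hIoo₂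
    have hβma : ContinuousAt βm a := hβmc.continuousAt hIoo₂
    have hβpa : ContinuousAt βp a := hβpc.continuousAt hIoo₂
    have hPa : P a (β a) := hβP a (hPex a haI.1 had)
    -- lower datum
    obtain ⟨p, hp₁, hlow⟩ : ∃ p, p < β a ∧ ∀ᶠ x in 𝓝 a, ∀ y, A x y → y < β x → y < p := by
      rcases hm with hm | hm
      · have ha := hβm a (hm ⟨hc₄a, had₄⟩)
        obtain ⟨p, hp₁, hp₂⟩ := exists_between ha.1.2
        refine ⟨p, hp₂, ?_⟩
        have hev : ∀ᶠ x in 𝓝 a, βm x < p := hβma.eventually (Iio_mem_nhds hp₁)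
        filter_upwards [hev, hnhd] with x hx hx' y hy hyβ
        exact lt_of_le_of_lt ((hβm x (hm hx')).2 y ⟨hy, hyβ⟩) hx
      · obtain ⟨p, hp⟩ := exists_lt (β a)
        refine ⟨p, hp, ?_⟩
        filter_upwards [hnhd] with x hx y hy hyβ
        exact (hm hx ⟨y, hy, hyβ⟩).elim
    -- upper datum
    obtain ⟨q, hq₁, hupp⟩ : ∃ q, β a < q ∧ ∀ᶠ x in 𝓝 a, ∀ y, A x y → β x < y → q < y := by
      rcases hp with hp | hp
      · have ha := hβp a (hp ⟨hc₄a, had₄⟩)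
        obtain ⟨q, hq₁, hq₂⟩ := exists_between ha.1.2
        refine ⟨q, hq₁, ?_⟩
        have hev : ∀ᶠ x in 𝓝 a, q < βp x := hβpa.eventually (Ioi_mem_nhds hq₂)
        filter_upwards [hev, hnhd] with x hx hx' y hy hyβ
        exact lt_of_lt_of_le hx ((hβp x (hp hx')).2 y ⟨hy, hyβ⟩)
      · obtain ⟨q, hq⟩ := exists_gt (β a)
        refine ⟨q, hq, ?_⟩
        filter_upwards [hnhd] with x hx y hy hyβ
        exact (hp hx ⟨y, hy, hyβ⟩).elim
    have hstar := eventually_eq_apply_of_lower_upper (A := A) hβa hp₁ hq₁ hlow hupp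
    have hunif' : (∀ᶠ x in 𝓝 a, A x (β x)) ∨ (∀ᶠ x in 𝓝 a, ¬ A x (β x)) := by
      rcases hunif with h | h
      · exact Or.inl (hnhd.mono fun x hx => h x (hsub hx))
      · exact Or.inr (hnhd.mono fun x hx => h x (hsub hx))
    exact hPa.1 (normal_of_eventually_eq_apply hp₁ hq₁ hβa hstar hunif')
  -- one of the four pieces is infinite, hence contains an interval
  have piece : ∀ s : Set M, (univ : Set M).Definable₁ L s → (Ioo c d₃ ∩ s).Infinite →
      ∃ c₄ d₄, c₄ < d₄ ∧ Ioo c₄ d₄ ⊆ Ioo c d₃ ∧ Ioo c₄ d₄ ⊆ s := by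
    intro s hs hinf'
    obtain ⟨c₄, d₄, hcd₄, hsub⟩ :=
      (hO (Ioo c d₃ ∩ s) (hIdef.inter hs)).exists_Ioo_subset_of_infinite hinf'
    exact ⟨c₄, d₄, hcd₄, fun x hx => (hsub hx).1, fun x hx => (hsub hx).2⟩
  have hcover : Ioo c d₃ ⊆ (Ioo c d₃ ∩ (Bm ∩ Bp)) ∪ (Ioo c d₃ ∩ (Bm \ Bp)) ∪
      (Ioo c d₃ ∩ (Bp \ Bm)) ∪ (Ioo c d₃ ∩ (Bm ∪ Bp)ᶜ) := by
    intro x hx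
    by_cases hxm : x ∈ Bm <;> by_cases hxp : x ∈ Bp
    · exact Or.inl (Or.inl (Or.inl ⟨hx, hxm, hxp⟩))
    · exact Or.inl (Or.inl (Or.inr ⟨hx, hxm, hxp⟩))
    · exact Or.inl (Or.inr ⟨hx, hxp, hxm⟩)
    · exact Or.inr ⟨hx, fun h => h.elim hxm hxp⟩
  have hinf4 := (Ioo_infinite hcd₃).mono hcover
  rw [infinite_union, infinite_union, infinite_union] at hinf4
  rcases hinf4 with ((h | h) | h) | h
  · obtain ⟨c₄, d₄, hcd₄, hsub, hs⟩ := piece (Bm ∩ Bp) (hBmdef.inter hBpdef) h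
    exact key c₄ d₄ hcd₄ hsub (Or.inl fun x hx => (hs hx).1) (Or.inl fun x hx => (hs hx).2)
  · obtain ⟨c₄, d₄, hcd₄, hsub, hs⟩ := piece (Bm \ Bp) (hBmdef.sdiff hBpdef) h
    exact key c₄ d₄ hcd₄ hsub (Or.inl fun x hx => (hs hx).1) (Or.inr fun x hx => (hs hx).2)
  · obtain ⟨c₄, d₄, hcd₄, hsub, hs⟩ := piece (Bp \ Bm) (hBpdef.sdiff hBmdef) h
    exact key c₄ d₄ hcd₄ hsub (Or.inr fun x hx => (hs hx).2) (Or.inl fun x hx => (hs hx).1)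
  · obtain ⟨c₄, d₄, hcd₄, hsub, hs⟩ := piece (Bm ∪ Bp)ᶜ (hBmdef.union hBpdef).compl h
    exact key c₄ d₄ hcd₄ hsub (Or.inr fun x hx hx' => hs hx (Or.inl hx'))
      (Or.inr fun x hx hx' => hs hx (Or.inr hx'))

end Topology

/-! ### The bad points are finite in number -/

/-- **The set of bad points is finite** (van den Dries 1998, Ch. 3, proof of (1.7): "Suppose
now that `𝓑` is not finite. We shall derive a contradiction"): for a definable `A ⊆ M²` with
finite fibres in an o-minimal structure on a dense linear order without endpoints (`<`
definable), all but finitely many `a ∈ M` are good, i.e. have `(a, b)` normal for every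
`b ∈ M ∪ {±∞}`.  An infinite definable set of bad points would contain an interval of points
of one of three kinds, each impossible (`false_of_forall_not_normalBot`,
`false_of_forall_not_normalTop`, `false_of_forall_isLeast`). [cite: Dries1998, Ch. 3 (1.7)] -/
theorem finite_setOf_not_good (hO : L.IsOMinimal M)
    (hlt : (univ : Set M).Definable L {v : Fin 2 → M | v 0 < v 1})
    (hA : (univ : Set M).Definable L {v : Fin 2 → M | A (v 0) (v 1)})
    (hfin : ∀ x, {y | A x y}.Finite) : {a | ¬ Good A a}.Finite := by
  letI : TopologicalSpace M := Preorder.topology M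
  haveI : OrderTopology M := ⟨rfl⟩
  by_contra hinf
  have hcover : {a | ¬ Good A a} ⊆ {a | ¬ NormalBot A a} ∪ {a | ¬ NormalTop A a} ∪
      {a | NormalBot A a ∧ NormalTop A a ∧ ∃ b, ¬ Normal A a b} := by
    intro a ha
    by_cases hb : NormalBot A a
    · by_cases ht : NormalTop A a
      · refine Or.inr ⟨hb, ht, ?_⟩
        by_contra hall
        exact ha ⟨hb, ht, fun b => not_not.1 fun h => hall ⟨b, h⟩⟩
      · exact Or.inl (Or.inr ht)
    · exact Or.inl (Or.inl hb)
  have hinf3 := (Set.not_finite.1 hinf |>.mono hcover)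
  rw [infinite_union, infinite_union] at hinf3
  rcases hinf3 with (h | h) | h
  · obtain ⟨c, d, hcd, hsub⟩ := (hO {a | ¬ NormalBot A a} (definable_setOf_not
      (definable_setOf_normalBot hlt hA))).exists_Ioo_subset_of_infinite h
    exact false_of_forall_not_normalBot hO hlt hA hfin hcd fun a hca had => hsub ⟨hca, had⟩
  · obtain ⟨c, d, hcd, hsub⟩ := (hO {a | ¬ NormalTop A a} (definable_setOf_not
      (definable_setOf_normalTop hlt hA))).exists_Ioo_subset_of_infinite h
    exact false_of_forall_not_normalTop hO hlt hA hfin hcd fun a hca had => hsub ⟨hca, had⟩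
  · have hdef : (univ : Set M).Definable₁ L
        {a | NormalBot A a ∧ NormalTop A a ∧ ∃ b, ¬ Normal A a b} := by
      refine definable_setOf_and (definable_setOf_normalBot hlt hA) (definable_setOf_and
        (definable_setOf_normalTop hlt hA) ?_)
      apply definable_setOf_exists
      exact definable_setOf_not (definable_setOf_rel (definable_setOf_normal hlt hA)
        (definableFun_proj _) (definableFun_proj _))
    obtain ⟨c, d, hcd, hsub⟩ := (hO _ hdef).exists_Ioo_subset_of_infinite h
    exact false_of_forall_isLeast hO hlt hA hfin hcd fun a hca had => hsub ⟨hca, had⟩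


end FinitenessLemma

end Literature.ModelTheory.ExponentialFields
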